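import Mathlib.Combinatorics.SimpleGraph.Finite
import Mathlib.GroupTheory.Perm.Basic
import HarnessLib

/-!
# Lifts (coverings) of a graph along edge permutations

Topic `Literature/Combinatorics/SimpleGraph`.  For a simple graph `B` on a linearly ordered
vertex type `W` and `a : ℕ`, an `a`-LIFT of `B` is determined by one permutation `π e` of `Fin a`
for every UPWARD EDGE `e = (x, y)`, `x < y`, `x ~ y` (`UpEdge B`): its vertex set is `W × Fin a`
(the FIBRE of `x` is `{x} × Fin a`) and `(x, i) ~ (y, π e i)`.  This is the standard random-lift
model of Amit–Linial (with all permutations chosen independently and uniformly); we use it as a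
source of `d`-regular SIMPLE graphs for the random-graph input of Conneryd–Ghannane–Pang 2025,
Theorem 6.1 (in place of the configuration model `𝒢_{n,d}` of the source: a lift of a simple
`d`-regular graph is automatically simple and `d`-regular).

* `UpEdge B`, `liftGraph B π : SimpleGraph (W × Fin a)`;
* `partner` / `liftGraph_adj_iff` — `(x,i)` has exactly one neighbour in the fibre of each
  neighbour `y` of `x`, none elsewhere;
* `neighborFinset_liftGraph`, **`degree_liftGraph : deg (x,i) = deg_B x`** — lifts of `d`-regular
  graphs are `d`-regular.

## References

* A. Amit, N. Linial, Random graph coverings I, Combinatorica 22 (2002) (the model). [folklore]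
* [ConnerydGhannanePang2025] arXiv:2511.17272, Thm. 6.1 (where the graphs are used).
-/

namespace Literature.Combinatorics.SimpleGraph

open Finset

variable {W : Type*} [LinearOrder W] (B : _root_.SimpleGraph W) {a : ℕ}

/-- The UPWARD EDGES of `B`: ordered pairs `(x, y)` with `x < y` and `x ~ y` (one per edge).
[folklore] -/
def UpEdge : Type _ :=
  {p : W × W // p.1 < p.2 ∧ B.Adj p.1 p.2}

/-- `UpEdge B` is finite for finite `W`. [folklore] -/
noncomputable instance UpEdge.instFintype [Fintype W] [DecidableRel B.Adj] : Fintype (UpEdge B) := by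
  unfold UpEdge; infer_instance

variable {B}

/-- THE LIFT of `B` along the edge permutations `π`: `(x, i) ~ (y, π ⟨(x,y)⟩ i)` for every upward
edge `(x, y)`. [folklore] -/
def liftGraph (π : UpEdge B → Equiv.Perm (Fin a)) : _root_.SimpleGraph (W × Fin a) where
  Adj u v := (∃ h : u.1 < v.1 ∧ B.Adj u.1 v.1, π ⟨(u.1, v.1), h⟩ u.2 = v.2) ∨
    (∃ h : v.1 < u.1 ∧ B.Adj v.1 u.1, π ⟨(v.1, u.1), h⟩ v.2 = u.2)
  symm := ⟨fun _ _ h => h.symm⟩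
  loopless := ⟨fun u h => by
    rcases h with ⟨h, -⟩ | ⟨h, -⟩ <;> exact lt_irrefl _ h.1⟩

/-- Classical decidability of adjacency in a lift. [folklore] -/
noncomputable instance liftGraph.instDecidableRel (π : UpEdge B → Equiv.Perm (Fin a)) :
    DecidableRel (liftGraph π).Adj :=
  Classical.decRel _

/-- Adjacent vertices of a lift lie over adjacent vertices of the base. [folklore] -/
theorem adj_of_liftGraph_adj {π : UpEdge B → Equiv.Perm (Fin a)} {u v : W × Fin a}
    (h : (liftGraph π).Adj u v) : B.Adj u.1 v.1 := by
  rcases h with ⟨h, -⟩ | ⟨h, -⟩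
  · exact h.2
  · exact h.2.symm

variable [DecidableRel B.Adj]

/-- THE PARTNER of `(x, i)` in the fibre of `y`: `π ⟨(x,y)⟩ i` if `x < y ~ x`, `(π ⟨(y,x)⟩)⁻¹ i` if
`y < x ~ y` (and `i`, irrelevant, otherwise). [folklore] -/
def partner (π : UpEdge B → Equiv.Perm (Fin a)) (x : W) (i : Fin a) (y : W) : Fin a :=
  if h : x < y ∧ B.Adj x y then π ⟨(x, y), h⟩ i
  else if h' : y < x ∧ B.Adj y x then (π ⟨(y, x), h'⟩).symm i else i

/-- Adjacency in a lift: `(x,i) ~ (y,j)` iff `x ~ y` in `B` and `j` is the partner of `(x,i)` over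
`y`. [folklore] -/
theorem liftGraph_adj_iff (π : UpEdge B → Equiv.Perm (Fin a)) {x y : W} {i j : Fin a} :
    (liftGraph π).Adj (x, i) (y, j) ↔ B.Adj x y ∧ partner π x i y = j := by
  constructor
  · rintro (⟨h, hij⟩ | ⟨h, hij⟩)
    · exact ⟨h.2, by rw [partner, dif_pos h]; exact hij⟩
    · refine ⟨h.2.symm, ?_⟩
      have hn : ¬ (x < y ∧ B.Adj x y) := fun h' => lt_asymm h.1 h'.1
      rw [partner, dif_neg hn, dif_pos h, Equiv.symm_apply_eq]
      exact hij.symm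
  · rintro ⟨hadj, hp⟩
    rcases lt_trichotomy x y with hlt | heq | hgt
    · left
      refine ⟨⟨hlt, hadj⟩, ?_⟩
      rw [partner, dif_pos ⟨hlt, hadj⟩] at hp
      exact hp
    · exact absurd (heq ▸ hadj) (B.loopless.irrefl _)
    · right
      have hn : ¬ (x < y ∧ B.Adj x y) := fun h' => lt_asymm hgt h'.1
      refine ⟨⟨hgt, hadj.symm⟩, ?_⟩
      rw [partner, dif_neg hn, dif_pos ⟨hgt, hadj.symm⟩, Equiv.symm_apply_eq] at hp
      exact hp.symm

variable [Fintype W]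

/-- The neighbours of `(x, i)` in the lift: one partner over each neighbour of `x`. [folklore] -/
theorem neighborFinset_liftGraph (π : UpEdge B → Equiv.Perm (Fin a)) (x : W) (i : Fin a) :
    (liftGraph π).neighborFinset (x, i) = (B.neighborFinset x).image fun y => (y, partner π x i y) := by
  ext ⟨y, j⟩
  rw [_root_.SimpleGraph.mem_neighborFinset, liftGraph_adj_iff, Finset.mem_image]
  constructor
  · rintro ⟨hadj, hp⟩
    exact ⟨y, (B.mem_neighborFinset x y).2 hadj, by rw [hp]⟩
  · rintro ⟨y', hy', h⟩
    obtain ⟨rfl, rfl⟩ := Prod.mk.injEq _ _ _ _ ▸ h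
    exact ⟨(B.mem_neighborFinset x y').1 hy', rfl⟩

/-- **Lifts preserve degrees**: `deg (x, i) = deg_B x`; in particular the lift of a `d`-regular
graph is `d`-regular. [folklore] -/
theorem degree_liftGraph (π : UpEdge B → Equiv.Perm (Fin a)) (x : W) (i : Fin a) :
    (liftGraph π).degree (x, i) = B.degree x := by
  rw [← _root_.SimpleGraph.card_neighborFinset_eq_degree, neighborFinset_liftGraph,
    Finset.card_image_of_injective _ fun y y' h => congrArg Prod.fst h,
    _root_.SimpleGraph.card_neighborFinset_eq_degree]

/-- Lifts of regular graphs are regular. [folklore] -/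
theorem isRegularOfDegree_liftGraph {d : ℕ} (hB : B.IsRegularOfDegree d)
    (π : UpEdge B → Equiv.Perm (Fin a)) : (liftGraph π).IsRegularOfDegree d :=
  fun v => by rw [degree_liftGraph]; exact hB v.1

end Literature.Combinatorics.SimpleGraph
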